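import Mathlib.Topology.Algebra.Order.Floor
import Summits.AtomisticToContinuum.Crystallization.Theorems.PalmUnimodularRigidityLayeredLawsSelectHcpZeroStressSymmetry

/-!
# `StrictSplittingRule` (stmt-AtomisticToContinuum-12560): the piecewise-affine CHART of the hcp tet–oct honeycomb (P1 interpolant object, part 1)

Route `FreeSplittingCertificates`, crux r3 `StrictSplittingRule` (H12⋆ = `stub_coreJointCoercive`), unit b2b-freesplit-B gen 20.
VALUE = the first brick of item (2) of HOME FAR-LEMMA-SPEC §15 (d) — the P1 INTERPOLANT OBJECT whose four hypotheses feed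
`farPencil4_weighted_integral_le_of_cellwise` (gen 18).  NOT a proof of H12⋆, NOT summit progress.

The hcp sites `hcpSite a h (k,i,j) = i·a₁ + j·a₂ + k·h·e₃ + ℓ_k·s` (`ℓ_k = 0/1` on even/odd layers, `s = (a₁+a₂)/3`) are the
images of the INTEGER points under the continuous, bijective, SLAB-WISE AFFINE chart
`T(t,x,y) = x·a₁ + y·a₂ + t·h·e₃ + tent(t)·s`, `tent` = distance to `2ℤ` (so `tent k = ℓ_k`, slope `±1` on each slab `k ≤ t ≤ k+1`).
Consequently the image under `T` of any tetrahedron of the unit cube `n + [0,1]³` lying in one slab is a genuine tetrahedron with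
hcp-site vertices; the reference decomposition of the cube into two corner tetrahedra and the four quarter-tetrahedra of the middle
octahedron (next file) is carried by `T` onto the tree's up- and down-tetrahedra and the quarters `G₁,…,G₄` of `hcpOctUp_receipts` /
`hcpOctDown_receipts`.  Here: `p1Tent` (closed form via `Int.fract`, continuity, slab formulas, values at integers), the chart `p1Chart`
and its explicit inverse `p1ChartInv` (two-sided inverse for `a, h ≠ 0`, both continuous), `p1Chart (p1Vec n) = hcpSite a h n`, and the
slab-wise affine form of the inverse chart (`p1ChartInv_eq_affine`).  [folklore: P1 finite elements on a multilattice]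
-/

noncomputable section

open Set

namespace Summit.AtomisticToContinuum.Crystallization.Theorems.StrictSplittingRuleBirth

open Literature.MathematicalPhysics.StatisticalMechanics
open Summit.AtomisticToContinuum.Crystallization.Theorems.PalmUnimodularRigidity.LayeredLawsSelectHcp

/-! ## The tent function (distance to the even integers) -/

/-- `p1Tent t` = distance from `t` to `2ℤ`: the continuous `2`-periodic piecewise-linear function with `p1Tent k = 0` for even
`k`, `= 1` for odd `k`, slope `±1` in between (closed form through `Int.fract`). [folklore] -/
def p1Tent (t : ℝ) : ℝ := 1 - |1 - 2 * Int.fract (t / 2)|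

/-- The tent function is continuous. -/
theorem continuous_p1Tent : Continuous p1Tent := by
  have h2 : Continuous ((fun s : ℝ => 1 - |1 - 2 * s|) ∘ Int.fract) := by
    refine ContinuousOn.comp_fract'' ?_ ?_
    · exact (continuous_const.sub ((continuous_const.sub (continuous_const.mul continuous_id)).abs)).continuousOn
    · norm_num
  exact h2.comp (continuous_id.div_const _)

/-- `0 ≤ p1Tent t ≤ 1`. -/
theorem p1Tent_mem_Icc (t : ℝ) : p1Tent t ∈ Icc (0 : ℝ) 1 := by
  have h0 := Int.fract_nonneg (t / 2)
  have h1 := Int.fract_lt_one (t / 2)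
  unfold p1Tent
  constructor
  · have : |1 - 2 * Int.fract (t / 2)| ≤ 1 := abs_le.2 ⟨by linarith, by linarith⟩
    linarith
  · linarith [abs_nonneg (1 - 2 * Int.fract (t / 2))]

/-- On an EVEN slab `[k, k+1]` the tent is `t − k`. -/
theorem p1Tent_of_even {k : ℤ} (hk : Even k) {t : ℝ} (h0 : (k : ℝ) ≤ t) (h1 : t ≤ k + 1) : p1Tent t = t - k := by
  obtain ⟨m, rfl⟩ := hk
  push_cast at h0 h1 ⊢
  have hf : Int.fract (t / 2) = t / 2 - m := by
    rw [Int.fract_eq_iff]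
    exact ⟨by linarith, by linarith, m, by ring⟩
  unfold p1Tent
  rw [hf, abs_of_nonneg (by linarith)]
  ring

/-- On an ODD slab `[k, k+1]` the tent is `k + 1 − t`. -/
theorem p1Tent_of_odd {k : ℤ} (hk : Odd k) {t : ℝ} (h0 : (k : ℝ) ≤ t) (h1 : t ≤ k + 1) : p1Tent t = k + 1 - t := by
  obtain ⟨m, rfl⟩ := hk
  push_cast at h0 h1 ⊢
  rcases lt_or_eq_of_le h1 with h1 | h1
  · have hf : Int.fract (t / 2) = t / 2 - m := by
      rw [Int.fract_eq_iff]
      exact ⟨by linarith, by linarith, m, by ring⟩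
    unfold p1Tent
    rw [hf, abs_of_nonpos (by linarith)]
    ring
  · have ht : t / 2 = ((m + 1 : ℤ) : ℝ) := by push_cast; linarith
    unfold p1Tent
    rw [ht, Int.fract_intCast]
    norm_num
    linarith

/-- At an integer the tent is the hcp layer label: `0` on even layers, `1` on odd layers. -/
theorem p1Tent_intCast (k : ℤ) : p1Tent k = haggLabel alternatingHagg k := by
  rw [haggLabel_alternating]
  split_ifs with hk
  · rw [p1Tent_of_even hk le_rfl (by linarith)]
    simp
  · rw [p1Tent_of_odd (Int.not_even_iff_odd.1 hk) le_rfl (by linarith)]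
    push_cast
    ring

/-- The tent is even around every even integer and, more usefully here, its slab formula in one line:
`p1Tent t = ℓ_k + ε_k (t − k)` on `[k, k+1]` with `ε_k = +1` (even `k`) / `−1` (odd `k`). -/
theorem p1Tent_slab (k : ℤ) {t : ℝ} (h0 : (k : ℝ) ≤ t) (h1 : t ≤ k + 1) :
    p1Tent t = (if Even k then 0 else 1) + (if Even k then 1 else -1) * (t - k) := by
  by_cases hk : Even k
  · rw [p1Tent_of_even hk h0 h1, if_pos hk, if_pos hk]; ring
  · rw [p1Tent_of_odd (Int.not_even_iff_odd.1 hk) h0 h1, if_neg hk, if_neg hk]; ring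

/-! ## The chart and its inverse -/

/-- The integer point of `ℝ³` attached to the site label `n = (k, i, j)` (coordinate order: layer `t`, then `x`, `y`). -/
def p1Vec (n : ℤ × ℤ × ℤ) : Fin 3 → ℝ := ![(n.1 : ℝ), (n.2.1 : ℝ), (n.2.2 : ℝ)]

/-- Layer coordinate of `p1Vec n`. -/
@[simp] theorem p1Vec_zero (n : ℤ × ℤ × ℤ) : p1Vec n 0 = n.1 := rfl
/-- `x`-coordinate of `p1Vec n`. -/
@[simp] theorem p1Vec_one (n : ℤ × ℤ × ℤ) : p1Vec n 1 = n.2.1 := rfl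
/-- `y`-coordinate of `p1Vec n`. -/
@[simp] theorem p1Vec_two (n : ℤ × ℤ × ℤ) : p1Vec n 2 = n.2.2 := rfl

/-- `p1Vec` is additive. -/
theorem p1Vec_add (n m : ℤ × ℤ × ℤ) : p1Vec (n + m) = p1Vec n + p1Vec m := by
  ext i; fin_cases i <;> simp [p1Vec]

/-- **The chart** `T(t,x,y) = x·a₁ + y·a₂ + t·h·e₃ + tent(t)·s` with `a₁ = (a,0,0)`, `a₂ = (a/2, a√3/2, 0)`, `s = (a/2, a√3/6, 0)`,
`e₃ = (0,0,1)`; input coordinates in the order `(t, x, y) = (q 0, q 1, q 2)` = (layer, `i`, `j`). [folklore] -/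
def p1Chart (a h : ℝ) (q : Fin 3 → ℝ) : Fin 3 → ℝ :=
  ![a * (q 1 + q 2 / 2 + p1Tent (q 0) / 2), a * √3 / 2 * (q 2 + p1Tent (q 0) / 3), q 0 * h]

/-- **The inverse chart** (explicit): `t = y₂/h`, `s = tent t`, `y = 2y₁/(a√3) − s/3`, `x = y₀/a − y/2 − s/2`. -/
def p1ChartInv (a h : ℝ) (y : Fin 3 → ℝ) : Fin 3 → ℝ :=
  ![y 2 / h, y 0 / a - (2 * y 1 / (a * √3) - p1Tent (y 2 / h) / 3) / 2 - p1Tent (y 2 / h) / 2,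
    2 * y 1 / (a * √3) - p1Tent (y 2 / h) / 3]

/-- First real coordinate of the chart. -/
@[simp] theorem p1Chart_apply_zero (a h : ℝ) (q : Fin 3 → ℝ) :
    p1Chart a h q 0 = a * (q 1 + q 2 / 2 + p1Tent (q 0) / 2) := rfl
/-- Second real coordinate of the chart. -/
@[simp] theorem p1Chart_apply_one (a h : ℝ) (q : Fin 3 → ℝ) :
    p1Chart a h q 1 = a * √3 / 2 * (q 2 + p1Tent (q 0) / 3) := rfl
/-- Third real coordinate of the chart (height). -/
@[simp] theorem p1Chart_apply_two (a h : ℝ) (q : Fin 3 → ℝ) : p1Chart a h q 2 = q 0 * h := rfl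
/-- Layer coordinate of the inverse chart. -/
@[simp] theorem p1ChartInv_apply_zero (a h : ℝ) (y : Fin 3 → ℝ) : p1ChartInv a h y 0 = y 2 / h := rfl
/-- `x`-coordinate of the inverse chart. -/
@[simp] theorem p1ChartInv_apply_one (a h : ℝ) (y : Fin 3 → ℝ) :
    p1ChartInv a h y 1 = y 0 / a - (2 * y 1 / (a * √3) - p1Tent (y 2 / h) / 3) / 2 - p1Tent (y 2 / h) / 2 := rfl
/-- `y`-coordinate of the inverse chart. -/
@[simp] theorem p1ChartInv_apply_two (a h : ℝ) (y : Fin 3 → ℝ) :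
    p1ChartInv a h y 2 = 2 * y 1 / (a * √3) - p1Tent (y 2 / h) / 3 := rfl

/-- `T⁻¹ ∘ T = id` (for `a, h ≠ 0`). -/
theorem p1ChartInv_p1Chart {a h : ℝ} (ha : a ≠ 0) (hh : h ≠ 0) (q : Fin 3 → ℝ) :
    p1ChartInv a h (p1Chart a h q) = q := by
  have h3 : (√3 : ℝ) ≠ 0 := by positivity
  have ht : q 0 * h / h = q 0 := by field_simp
  ext i
  fin_cases i
  · simp [ht]
  · simp only [Fin.mk_one, p1ChartInv_apply_one, p1Chart_apply_zero, p1Chart_apply_one, p1Chart_apply_two, ht]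
    field_simp
    ring
  · simp only [Fin.reduceFinMk, p1ChartInv_apply_two, p1Chart_apply_one, p1Chart_apply_two, ht]
    field_simp
    ring

/-- `T ∘ T⁻¹ = id` (for `a, h ≠ 0`). -/
theorem p1Chart_p1ChartInv {a h : ℝ} (ha : a ≠ 0) (hh : h ≠ 0) (y : Fin 3 → ℝ) :
    p1Chart a h (p1ChartInv a h y) = y := by
  have h3 : (√3 : ℝ) ≠ 0 := by positivity
  ext i
  fin_cases i
  · simp only [Fin.zero_eta, p1Chart_apply_zero, p1ChartInv_apply_one, p1ChartInv_apply_two, p1ChartInv_apply_zero]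
    field_simp
    ring
  · simp only [Fin.mk_one, p1Chart_apply_one, p1ChartInv_apply_two, p1ChartInv_apply_zero]
    field_simp
    ring
  · simp only [Fin.reduceFinMk, p1Chart_apply_two, p1ChartInv_apply_zero]
    field_simp

/-- The chart is a bijection of `ℝ³` (for `a, h ≠ 0`). -/
theorem p1Chart_bijective {a h : ℝ} (ha : a ≠ 0) (hh : h ≠ 0) : Function.Bijective (p1Chart a h) :=
  Function.bijective_iff_has_inverse.2 ⟨p1ChartInv a h, p1ChartInv_p1Chart ha hh, p1Chart_p1ChartInv ha hh⟩

/-- The chart is continuous. -/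
theorem continuous_p1Chart (a h : ℝ) : Continuous (p1Chart a h) := by
  have hT : Continuous fun q : Fin 3 → ℝ => p1Tent (q 0) := continuous_p1Tent.comp (continuous_apply 0)
  refine continuous_pi fun i => ?_
  fin_cases i
  · simp only [Fin.zero_eta, p1Chart_apply_zero]
    exact continuous_const.mul (((continuous_apply 1).add ((continuous_apply 2).div_const _)).add (hT.div_const _))
  · simp only [Fin.mk_one, p1Chart_apply_one]
    exact continuous_const.mul ((continuous_apply 2).add (hT.div_const _))
  · simp only [Fin.reduceFinMk, p1Chart_apply_two]
    exact (continuous_apply 0).mul continuous_const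

/-- The inverse chart is continuous. -/
theorem continuous_p1ChartInv (a h : ℝ) : Continuous (p1ChartInv a h) := by
  have ht : Continuous fun y : Fin 3 → ℝ => y 2 / h := (continuous_apply 2).div_const _
  have hT : Continuous fun y : Fin 3 → ℝ => p1Tent (y 2 / h) := continuous_p1Tent.comp ht
  have hη : Continuous fun y : Fin 3 → ℝ => 2 * y 1 / (a * √3) - p1Tent (y 2 / h) / 3 :=
    ((continuous_const.mul (continuous_apply 1)).div_const _).sub (hT.div_const _)
  refine continuous_pi fun i => ?_
  fin_cases i
  · simpa using ht
  · simp only [Fin.mk_one, p1ChartInv_apply_one]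
    exact (((continuous_apply 0).div_const _).sub (hη.div_const _)).sub (hT.div_const _)
  · simpa using hη

/-- **The chart carries the integer points onto the hcp sites**: `T(k,i,j) = hcpSite a h (k,i,j)` (componentwise). -/
theorem p1Chart_p1Vec (a h : ℝ) (n : ℤ × ℤ × ℤ) (i : Fin 3) : p1Chart a h (p1Vec n) i = hcpSite a h n i := by
  fin_cases i
  · simp only [Fin.zero_eta, p1Chart_apply_zero, p1Vec_one, p1Vec_two, p1Vec_zero, p1Tent_intCast, hcpSite_apply_zero]
  · simp only [Fin.mk_one, p1Chart_apply_one, p1Vec_two, p1Vec_zero, p1Tent_intCast, hcpSite_apply_one]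
  · simp only [Fin.reduceFinMk, p1Chart_apply_two, p1Vec_zero, hcpSite_apply_two]

/-- The inverse chart sends the hcp site `y_n` to the integer point `n`. -/
theorem p1ChartInv_hcpSite {a h : ℝ} (ha : a ≠ 0) (hh : h ≠ 0) (n : ℤ × ℤ × ℤ) :
    p1ChartInv a h (fun i => hcpSite a h n i) = p1Vec n := by
  have : (fun i => hcpSite a h n i) = p1Chart a h (p1Vec n) := funext fun i => (p1Chart_p1Vec a h n i).symm
  rw [this, p1ChartInv_p1Chart ha hh]

/-! ## Slab-wise affine form of the inverse chart -/

/-- The layer coordinate of `T⁻¹ y` is `y₂ / h`: `T⁻¹` maps the real slab `k·h ≤ y₂ ≤ (k+1)·h` onto the chart slab `k ≤ t ≤ k+1`. -/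
theorem p1ChartInv_layer (a h : ℝ) (y : Fin 3 → ℝ) : p1ChartInv a h y 0 = y 2 / h := rfl

/-- The sign of the tent's slope on slab `k`: `+1` for even `k`, `−1` for odd `k`. -/
def p1Sgn (k : ℤ) : ℝ := if Even k then 1 else -1

/-- The tent's value at the left end of slab `k`: the layer label `ℓ_k`. -/
def p1Lab (k : ℤ) : ℝ := if Even k then 0 else 1

/-- **Slab-wise AFFINE inverse chart**: the map that agrees with `T⁻¹` on the real slab over `[k, k+1]`, written out with the slab's
slope sign `ε = p1Sgn k` and label `ℓ = p1Lab k` in place of the tent (so it is affine in `y` on all of `ℝ³`). -/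
def p1ChartInvAff (a h : ℝ) (k : ℤ) (y : Fin 3 → ℝ) : Fin 3 → ℝ :=
  ![y 2 / h,
    y 0 / a - (2 * y 1 / (a * √3) - (p1Lab k + p1Sgn k * (y 2 / h - k)) / 3) / 2 - (p1Lab k + p1Sgn k * (y 2 / h - k)) / 2,
    2 * y 1 / (a * √3) - (p1Lab k + p1Sgn k * (y 2 / h - k)) / 3]

/-- On the real slab over `[k, k+1]` the inverse chart IS the affine map `p1ChartInvAff a h k`. -/
theorem p1ChartInv_eq_affine (a h : ℝ) (k : ℤ) {y : Fin 3 → ℝ} (h0 : (k : ℝ) ≤ y 2 / h) (h1 : y 2 / h ≤ k + 1) :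
    p1ChartInv a h y = p1ChartInvAff a h k y := by
  have hT : p1Tent (y 2 / h) = p1Lab k + p1Sgn k * (y 2 / h - k) := by
    rw [p1Tent_slab k h0 h1]; rfl
  ext i
  fin_cases i
  · rfl
  · simp only [Fin.mk_one, p1ChartInv_apply_one, hT]; rfl
  · simp only [Fin.reduceFinMk, p1ChartInv_apply_two, hT]; rfl

/-- The affine inverse chart splits as (value at `0`) + (a map additive and homogeneous in `y`): its LINEAR PART, as a function. -/
def p1ChartInvLin (a h : ℝ) (k : ℤ) (y : Fin 3 → ℝ) : Fin 3 → ℝ :=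
  ![y 2 / h,
    y 0 / a - (2 * y 1 / (a * √3) - p1Sgn k * (y 2 / h) / 3) / 2 - p1Sgn k * (y 2 / h) / 2,
    2 * y 1 / (a * √3) - p1Sgn k * (y 2 / h) / 3]

/-- `p1ChartInvAff k y = p1ChartInvAff k 0 + p1ChartInvLin k y`. -/
theorem p1ChartInvAff_eq (a h : ℝ) (k : ℤ) (y : Fin 3 → ℝ) :
    p1ChartInvAff a h k y = p1ChartInvAff a h k 0 + p1ChartInvLin a h k y := by
  ext i
  fin_cases i <;> simp [p1ChartInvAff, p1ChartInvLin] <;> ring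

/-- The linear part as a continuous linear map. -/
def p1ChartInvCLM (a h : ℝ) (k : ℤ) : (Fin 3 → ℝ) →L[ℝ] (Fin 3 → ℝ) :=
  LinearMap.toContinuousLinearMap
    { toFun := p1ChartInvLin a h k
      map_add' := fun y z => by
        ext i; fin_cases i <;> simp [p1ChartInvLin] <;> ring
      map_smul' := fun c y => by
        ext i; fin_cases i <;> simp [p1ChartInvLin] <;> ring }

/-- The continuous linear map acts as `p1ChartInvLin`. -/
@[simp] theorem p1ChartInvCLM_apply (a h : ℝ) (k : ℤ) (y : Fin 3 → ℝ) :
    p1ChartInvCLM a h k y = p1ChartInvLin a h k y := rfl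

/-- **On the real slab over `[k, k+1]`**: `T⁻¹ y = c_k + L_k y` with `L_k = p1ChartInvCLM a h k` continuous linear. -/
theorem p1ChartInv_eq_clm (a h : ℝ) (k : ℤ) {y : Fin 3 → ℝ} (h0 : (k : ℝ) ≤ y 2 / h) (h1 : y 2 / h ≤ k + 1) :
    p1ChartInv a h y = p1ChartInvAff a h k 0 + p1ChartInvCLM a h k y := by
  rw [p1ChartInv_eq_affine a h k h0 h1, p1ChartInvAff_eq]; rfl

end Summit.AtomisticToContinuum.Crystallization.Theorems.StrictSplittingRuleBirth
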